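import Literature.Analysis.FluidPDE.CheskidovDaiPieces
import HarnessLib

/-!
# The nonlinear term of the dyadic `H¹` energy balance in LOW-MODE form (Cheskidov–Dai), block by block

Analysis/FluidPDE support file (serves the discharge of the named fact
`Literature.Analysis.FluidPDE.cheskidov_dai_occupation_regular` — Cheskidov–Dai, arXiv:1507.06611 =
Proc. Edinburgh Math. Soc. (2025), Thm. 1.1). For a divergence-free smooth `L²` field `v` on `ℝ^ι` with
`a_l = ‖Δ̇_l v‖₂`, `s_l = ‖Δ̇_l v‖_∞`, the nonlinear term of the `j`-th block balance
`N_j = ∫ ⟪Δ̇_j v, Δ̇_j ((v·∇)v)⟫` satisfies (`enorm_integral_inner_blockFn_convect_le_lowMode`)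

  `‖N_j‖ ≤ (A₁ + A₂) a_j ∑_{|m|≤2} a_{j+m} T_{j+m} + A₃ s_j Q(j)`,
  `T_l = ∑_{l' ≤ l-3} 2^{l'} s_{l'}` (`paraT` of the WEIGHTED sups), `Q(j) = ∑_{l ≥ j-4, |m| ≤ 2} a_l 2^{l+m} a_{l+m}`
  (`paraQ2`), with constants `A_i` made of Littlewood–Paley constants only

— the block-by-block form of the paper's (3.6) in the tree's `H¹` (`s = 1`) dyadic language. Every
low-frequency sup carries its own wavenumber and every high block appears undifferentiated: the low–high
pieces with `l ≤ j-5` go through the commutator form (`CheskidovDaiPieces`: transport parts cancel over the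
window `|l'-j| ≤ 2`, the commutator costs `2^{l-j} s_l`), all other pieces are bounded directly with the
sup norm on the lowest block present; the double block sum is resummed with the shapes of
`CheskidovShvydkoyNonlinear` (`tsum_tsum_lowHigh_eq`, `_highLow_eq`, `_diag_eq`).

Not here: the summation over `j` with the weights `4^j` and the split of the sups at the dissipation
wavenumber (`CheskidovDaiWeightedSum.lean`), the time integration and the bootstrap.

Used by `CheskidovDaiWeightedSum.sum_Icc_weighted_nonlinear_le_lowMode`.

## References

* A. Cheskidov, M. Dai, arXiv:1507.06611 = Proc. Edinburgh Math. Soc. (2025), §3.1, (3.6).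
  [CheskidovDai2015]
-/

noncomputable section

open MeasureTheory Filter Topology Function Set
open Literature.Analysis.FunctionSpaces
open scoped ENNReal NNReal RealInnerProductSpace

namespace Literature.Analysis.FluidPDE

/-! ## The low-mode bound on the nonlinear term of one block -/

section Assembly

variable {ι : Type*} [Fintype ι] [Nonempty ι] (K : LPBounds ι)

/-- `2^{-j} 2^{l'} ≤ 4` in `ℝ≥0∞` for `l' ≤ j + 2`. [folklore] -/
private theorem two_zpow_neg_mul_le_four {j l' : ℤ} (h : l' ≤ j + 2) :
    (2 : ℝ≥0∞) ^ (-j) * (2 : ℝ≥0∞) ^ l' ≤ 4 := by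
  rw [← ENNReal.zpow_add two_ne_zero ENNReal.ofNat_ne_top]
  calc (2 : ℝ≥0∞) ^ (-j + l') ≤ 2 ^ (2 : ℤ) := ENNReal.zpow_le_of_le (by norm_num) (by omega)
    _ = 4 := by rw [show (2 : ℤ) = (2 : ℕ) by rfl, zpow_natCast]; norm_num

/-- `2^{l'} ≤ 64 · 2^{l}` in `ℝ≥0∞` for `l' ≤ l + 6`. [folklore] -/
private theorem two_zpow_le_mul_of_le_add_six {l l' : ℤ} (h : l' ≤ l + 6) :
    (2 : ℝ≥0∞) ^ l' ≤ 64 * (2 : ℝ≥0∞) ^ l := by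
  calc (2 : ℝ≥0∞) ^ l' ≤ 2 ^ (6 + l) := ENNReal.zpow_le_of_le (by norm_num) (by omega)
    _ = 64 * (2 : ℝ≥0∞) ^ l := by
        rw [ENNReal.zpow_add two_ne_zero ENNReal.ofNat_ne_top, show (6 : ℤ) = (6 : ℕ) by rfl, zpow_natCast]; norm_num

/-- The commutator factor `ofReal (2^{-j} M₁) = 2^{-j} ofReal M₁`. [folklore] -/
private theorem ofReal_two_rpow_neg_mul (j : ℤ) (M : ℝ) :
    ENNReal.ofReal ((2 : ℝ) ^ (-(j : ℝ)) * M) = (2 : ℝ≥0∞) ^ (-j) * ENNReal.ofReal M := by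
  rw [ENNReal.ofReal_mul (Real.rpow_nonneg zero_le_two _), show (-(j : ℝ)) = ((-j : ℤ) : ℝ) by push_cast; ring,
    Real.rpow_intCast, ofReal_two_zpow]

/-- **The low-mode bound on the nonlinear term of the `j`-th block balance** (Cheskidov–Dai 2015,
§3.1, estimate (3.6) block by block, `H¹` dyadic form). Let `v` be a divergence-free smooth `L²` field on
`ℝ^ι`, `a_l = ‖Δ̇_l v‖₂`, `s_l = ‖Δ̇_l v‖_∞`, `t_l = 2^l s_l`, `c_l = 2^l a_l`, and let `C_∞'`, `C_L` be the
sup-Bernstein and block-Lipschitz constants (`exists_eLpNorm_top_fderiv_blockFn_le`,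
`exists_lipschitz_blockFn_le`). Then
`‖∫ ⟪Δ̇_j v, Δ̇_j((v·∇)v)⟫‖ ≤ (A₁ + A₂) a_j ∑_{|m|≤2} a_{j+m} T_{j+m} + A₃ s_j Q(j)` with
`T = paraT t` (`T_l = ∑_{l' ≤ l-3} 2^{l'} s_{l'}`), `Q = paraQ2 a c`, and
`A₁ = d (4 d C_L M₁ C_b + 64 C₂ C_b)`, `A₂ = d C₂ C_∞'`, `A₃ = d ‖K₀‖₁ C_b` (`d = dim`, `M₁ = ∫ |K₀| ‖·‖`):
every sup norm enters with its own wavenumber — the LOW-high pieces far from the diagonal through the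
commutator `[Δ̇_j, Δ̇_l v·∇]` after the transport parts cancel, all other pieces by Hölder and Bernstein.
[cite: CheskidovDai2015, §3.1 (3.6)] -/
theorem enorm_integral_inner_blockFn_convect_le_lowMode
    {Csup : ℝ≥0} (hCsup : ∀ (m : EuclideanSpace ℝ ι) (l : ℤ) (w : EuclideanSpace ℝ ι → EuclideanSpace ℝ ι), IsC1L2Field w →
      eLpNorm (fun x => fderiv ℝ (blockFn l w) x m) ∞ volume ≤ Csup * ENNReal.ofReal ((2 : ℝ) ^ l * ‖m‖) * eLpNorm (blockFn l w) ∞ volume)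
    {CL : ℝ≥0} (hCL : ∀ (l : ℤ) (w : EuclideanSpace ℝ ι → EuclideanSpace ℝ ι), IsSmoothL2Field w →
      (∀ x y, ‖blockFn l w x - blockFn l w y‖ ≤
        (∑ i, (eLpNorm (fun z => fderiv ℝ (blockFn l w) z (stdOrthonormalBasis ℝ (EuclideanSpace ℝ ι) i)) ∞ volume).toReal) *
          ‖x - y‖) ∧
      ENNReal.ofReal (∑ i, (eLpNorm (fun z => fderiv ℝ (blockFn l w) z (stdOrthonormalBasis ℝ (EuclideanSpace ℝ ι) i))
          ∞ volume).toReal) ≤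
        Fintype.card (Fin (Module.finrank ℝ (EuclideanSpace ℝ ι))) * (CL * ENNReal.ofReal ((2 : ℝ) ^ l) *
          eLpNorm (blockFn l w) ∞ volume))
    {v : EuclideanSpace ℝ ι → EuclideanSpace ℝ ι} (hv : IsSmoothL2Field v) (hdiv : VectorCalculus.IsDivFree v) (j : ℤ) :
    ‖∫ x, ⟪blockFn j v x, blockFn j (convect v v) x⟫‖ₑ ≤
      (Fintype.card (Fin (Module.finrank ℝ (EuclideanSpace ℝ ι))) *
          (4 * Fintype.card (Fin (Module.finrank ℝ (EuclideanSpace ℝ ι))) * CL *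
              ENNReal.ofReal (∫ z : EuclideanSpace ℝ ι, ‖blockKernel (EuclideanSpace ℝ ι) 0 z‖ * ‖z‖) * K.Cb +
            64 * K.C₂ * K.Cb) +
        Fintype.card (Fin (Module.finrank ℝ (EuclideanSpace ℝ ι))) * K.C₂ * Csup) *
        (blockL2 v j * ∑ m ∈ Finset.Icc (-2 : ℤ) 2, blockL2 v (j + m) *
          paraT (fun l => (2 : ℝ≥0∞) ^ l * blockSup v l) (j + m)) +
      Fintype.card (Fin (Module.finrank ℝ (EuclideanSpace ℝ ι))) *
          (∫⁻ z, ‖blockKernel (EuclideanSpace ℝ ι) 0 z‖ₑ) * K.Cb *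
        (blockSup v j * paraQ2 (blockL2 v) (fun l => (2 : ℝ≥0∞) ^ l * blockL2 v l) j) := by
  haveI : Fact (1 ≤ (2 : ℝ≥0∞)) := ⟨one_le_two⟩
  set b := stdOrthonormalBasis ℝ (EuclideanSpace ℝ ι) with hb
  set d : ℝ≥0∞ := (Fintype.card (Fin (Module.finrank ℝ (EuclideanSpace ℝ ι))) : ℝ≥0∞) with hd
  set M₁ : ℝ≥0∞ := ENNReal.ofReal (∫ z : EuclideanSpace ℝ ι, ‖blockKernel (EuclideanSpace ℝ ι) 0 z‖ * ‖z‖) with hM₁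
  set C₁ : ℝ≥0∞ := ∫⁻ z, ‖blockKernel (EuclideanSpace ℝ ι) 0 z‖ₑ with hC₁
  set a : ℤ → ℝ≥0∞ := blockL2 v with ha
  set s : ℤ → ℝ≥0∞ := blockSup v with hs
  set t : ℤ → ℝ≥0∞ := fun l => (2 : ℝ≥0∞) ^ l * blockSup v l with ht
  set c : ℤ → ℝ≥0∞ := fun l => (2 : ℝ≥0∞) ^ l * blockL2 v l with hc
  set A₁ : ℝ≥0∞ := d * (4 * d * CL * M₁ * K.Cb + 64 * K.C₂ * K.Cb) with hA₁
  set A₂ : ℝ≥0∞ := d * K.C₂ * Csup with hA₂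
  set A₃ : ℝ≥0∞ := d * C₁ * K.Cb with hA₃
  -- the fields
  have hv2 : MemLp v 2 volume := hv.memLp_two
  have hvj : IsSmoothL2Field (blockFn j v) := hv.blockFn j
  have hvl : ∀ l, HasBoundedDerivs (blockFn l v) := fun l => hv.toHasBoundedDerivs.blockFn l
  have hvl2 : ∀ l, MemLp (blockFn l v) 2 volume := fun l => memLp_blockFn l hv2 one_le_two
  have hvlt : ∀ l, MemLp (blockFn l v) ∞ volume := fun l => memLp_top_blockFn l hv2
  set w : Fin (Module.finrank ℝ (EuclideanSpace ℝ ι)) → EuclideanSpace ℝ ι → EuclideanSpace ℝ ι :=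
    fun i y => fderiv ℝ v y (b i) with hw
  have hwS : ∀ i, IsSmoothL2Field (w i) := fun i => hv.fderiv_apply (b i)
  have hw2 : ∀ i, MemLp (w i) 2 volume := fun i => (hwS i).memLp_two
  have hwt : ∀ i, MemLp (w i) ∞ volume := fun i => memLp_top_of_hasBoundedDerivs (hwS i).toHasBoundedDerivs
  have hconvw : ∀ i, Tendsto (fun N : ℕ => eLpNorm (w i - ∑ l ∈ Finset.Icc (-(N : ℤ)) N, blockFn l (w i)) 2 volume)
      atTop (𝓝 0) := fun i => K.tendsto (w i) (hw2 i)
  have hblockw : ∀ i l', blockFn l' (w i) = fun y => fderiv ℝ (blockFn l' v) y (b i) := fun i l' =>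
    ((IsC1L2Field.of_isSmoothL2Field hv).fderiv_blockFn_apply l' (b i)).symm
  have hbi : ∀ i, ‖b i‖ ≤ 1 := fun i => le_of_eq (b.orthonormal.1 i)
  -- the bound `B(l, l')`
  set B : ℤ → ℤ → ℝ≥0∞ := fun l l' =>
    A₁ * a j * (if l ≤ l' - 3 ∧ |l' - j| ≤ 2 then t l * a l' else 0) +
    A₂ * a j * (if l' ≤ l - 3 ∧ |l - j| ≤ 2 then a l * t l' else 0) +
    A₃ * s j * (if |l' - l| ≤ 2 ∧ j - 4 ≤ l then a l * c l' else 0) with hB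
  -- Step 1: the nonlinear term as trilinear pieces
  rw [integral_inner_blockFn_convect_eq_sum_trilin j hvj.memLp_two hv.toHasBoundedDerivs hv]
  -- Step 2: expansion of the first factor
  have hleft : Tendsto (fun N : ℕ => ∑ l ∈ Finset.Icc (-(N : ℤ)) N, ∑ i, trilin j (blockFn j v) (b i) (blockFn l v) (w i))
      atTop (𝓝 (∑ i, trilin j (blockFn j v) (b i) v (w i))) := by
    have h := tendsto_finsetSum (Finset.univ) fun i (_ : i ∈ Finset.univ) =>
      tendsto_sum_trilin_blockFn_left j hvj.memLp_two (hbi i) hv2 (hwt i) (K.tendsto v hv2)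
    refine h.congr fun N => ?_
    rw [Finset.sum_comm]
  refine (enorm_le_tsum_of_tendsto_sum hleft).trans ?_
  -- Step 3: the bound for each `l`
  have hstep3 : ∀ l, ‖∑ i, trilin j (blockFn j v) (b i) (blockFn l v) (w i)‖ₑ ≤ ∑' l', B l l' := by
    intro l
    by_cases hfar : l ≤ j - 5
    · -- far low–high pieces: commutator form, transport cancels
      have hvan : ∀ i, ∀ l', l' ∉ Finset.Icc (j - 2) (j + 2) →
          trilin j (blockFn j v) (b i) (blockFn l v) (blockFn l' (w i)) = 0 := by
        intro i l' hl'
        refine trilin_blockFn_blockFn_eq_zero' ?_ _ _ hv2 (hw2 i)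
        simp only [Finset.mem_Icc, not_and_or, not_le] at hl'
        unfold ParaproductVanishing
        rcases hl' with hl' | hl'
        · left
          have hm : max l l' ≤ j - 3 := max_le (by omega) (by omega)
          omega
        · right; right; constructor <;> omega
      have hexp : ∑ i, trilin j (blockFn j v) (b i) (blockFn l v) (w i) =
          ∑ l' ∈ Finset.Icc (j - 2) (j + 2), ∑ i, trilin j (blockFn j v) (b i) (blockFn l v)
            (fun y => fderiv ℝ (blockFn l' v) y (b i)) := by
        rw [Finset.sum_comm]
        refine Finset.sum_congr rfl fun i _ => ?_
        rw [trilin_eq_sum_of_vanishing j hvj.memLp_two (hbi i) (hvlt l) (hw2 i) (hconvw i) _ (hvan i)]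
        exact Finset.sum_congr rfl fun l' _ => by rw [hblockw i l']
      obtain ⟨hLip, hLle⟩ := hCL l v hv
      set L : ℝ := ∑ i, (eLpNorm (fun z => fderiv ℝ (blockFn l v) z (b i)) ∞ volume).toReal with hLdef
      have hL0 : 0 ≤ L := Finset.sum_nonneg fun i _ => ENNReal.toReal_nonneg
      have hrw : ∑ l' ∈ Finset.Icc (j - 2) (j + 2), ∑ i, trilin j (blockFn j v) (b i) (blockFn l v)
            (fun y => fderiv ℝ (blockFn l' v) y (b i)) =
          ∑ l' ∈ Finset.Icc (j - 2) (j + 2),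
            ((∫ x, ⟪blockFn j v x, convect (blockFn l v) (blockFn j (blockFn l' v)) x⟫) +
              ∑ i, ∫ x, ⟪blockFn j v x,
                blockFn j (fun y => ⟪blockFn l v y, b i⟫ • fderiv ℝ (blockFn l' v) y (b i)) x -
                  ⟪blockFn l v x, b i⟫ • blockFn j (fun y => fderiv ℝ (blockFn l' v) y (b i)) x⟫) :=
        Finset.sum_congr rfl fun l' _ => sum_trilin_eq_transport_add_comm j hvj.memLp_two (hvl l) (hv.blockFn l')
      rw [hexp, hrw, Finset.sum_add_distrib, sum_window_integral_inner_transport_eq_zero j hv hdiv l, zero_add]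
      calc ‖∑ l' ∈ Finset.Icc (j - 2) (j + 2), ∑ i, ∫ x, ⟪blockFn j v x,
              blockFn j (fun y => ⟪blockFn l v y, b i⟫ • fderiv ℝ (blockFn l' v) y (b i)) x -
                ⟪blockFn l v x, b i⟫ • blockFn j (fun y => fderiv ℝ (blockFn l' v) y (b i)) x⟫‖ₑ
          ≤ ∑ l' ∈ Finset.Icc (j - 2) (j + 2), ∑ i, ‖∫ x, ⟪blockFn j v x,
              blockFn j (fun y => ⟪blockFn l v y, b i⟫ • fderiv ℝ (blockFn l' v) y (b i)) x -
                ⟪blockFn l v x, b i⟫ • blockFn j (fun y => fderiv ℝ (blockFn l' v) y (b i)) x⟫‖ₑ :=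
            (enorm_sum_le _ _).trans (Finset.sum_le_sum fun l' _ => enorm_sum_le _ _)
        _ ≤ ∑ l' ∈ Finset.Icc (j - 2) (j + 2), ∑ _i : Fin (Module.finrank ℝ (EuclideanSpace ℝ ι)),
              a j * (ENNReal.ofReal L * ((2 : ℝ≥0∞) ^ (-j) * M₁) * (K.Cb * (2 : ℝ≥0∞) ^ l' * a l')) := by
            refine Finset.sum_le_sum fun l' _ => Finset.sum_le_sum fun i _ => ?_
            have h := enorm_integral_inner_comm_le j K hvj.memLp_two hv i l l' hL0 hLip
            rw [ofReal_two_rpow_neg_mul, ofReal_two_zpow] at h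
            exact h
        _ ≤ ∑ l' ∈ Finset.Icc (j - 2) (j + 2), ∑ _i : Fin (Module.finrank ℝ (EuclideanSpace ℝ ι)),
              a j * ((d * (CL * (2 : ℝ≥0∞) ^ l * s l)) * ((2 : ℝ≥0∞) ^ (-j) * M₁) * (K.Cb * (2 : ℝ≥0∞) ^ l' * a l')) := by
            gcongr with l' _ i _
            rw [← ofReal_two_zpow]; exact hLle
        _ = ∑ l' ∈ Finset.Icc (j - 2) (j + 2), d * (a j * ((d * (CL * (2 : ℝ≥0∞) ^ l * s l)) *
              ((2 : ℝ≥0∞) ^ (-j) * M₁) * (K.Cb * (2 : ℝ≥0∞) ^ l' * a l'))) := by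
            refine Finset.sum_congr rfl fun l' _ => ?_
            rw [Finset.sum_const, Finset.card_univ, nsmul_eq_mul]
        _ ≤ ∑ l' ∈ Finset.Icc (j - 2) (j + 2), B l l' := by
            refine Finset.sum_le_sum fun l' hl' => ?_
            simp only [Finset.mem_Icc] at hl'
            have hLH : l ≤ l' - 3 ∧ |l' - j| ≤ 2 := ⟨by omega, by rw [abs_le]; omega⟩
            have h4 : (2 : ℝ≥0∞) ^ (-j) * (2 : ℝ≥0∞) ^ l' ≤ 4 := two_zpow_neg_mul_le_four hl'.2
            calc d * (a j * ((d * (CL * (2 : ℝ≥0∞) ^ l * s l)) * ((2 : ℝ≥0∞) ^ (-j) * M₁) * (K.Cb * (2 : ℝ≥0∞) ^ l' * a l')))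
                = d * (d * CL * M₁ * K.Cb) * ((2 : ℝ≥0∞) ^ (-j) * (2 : ℝ≥0∞) ^ l') * a j * (t l * a l') := by
                  simp only [ht]; ring
              _ ≤ d * (d * CL * M₁ * K.Cb) * 4 * a j * (t l * a l') := by gcongr
              _ ≤ A₁ * a j * (t l * a l') := by
                  gcongr
                  rw [hA₁]
                  calc d * (d * CL * M₁ * K.Cb) * 4 = d * (4 * d * CL * M₁ * K.Cb) := by ring
                    _ ≤ d * (4 * d * CL * M₁ * K.Cb + 64 * K.C₂ * K.Cb) := by gcongr; exact le_self_add
              _ ≤ B l l' := by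
                  simp only [hB, if_pos hLH]
                  exact le_add_of_le_of_nonneg (le_add_of_le_of_nonneg le_rfl bot_le) bot_le
        _ ≤ ∑' l', B l l' := ENNReal.sum_le_tsum _
    · -- near and high pieces: termwise
      push Not at hfar
      calc ‖∑ i, trilin j (blockFn j v) (b i) (blockFn l v) (w i)‖ₑ
          ≤ ∑ i, ‖trilin j (blockFn j v) (b i) (blockFn l v) (w i)‖ₑ := enorm_sum_le _ _
        _ ≤ ∑ i, ∑' l', ‖trilin j (blockFn j v) (b i) (blockFn l v) (blockFn l' (w i))‖ₑ :=
            Finset.sum_le_sum fun i _ => enorm_trilin_le_tsum_right j hvj.memLp_two (hbi i) (hvlt l) (hw2 i) (hconvw i)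
        _ = ∑' l', ∑ i, ‖trilin j (blockFn j v) (b i) (blockFn l v) (blockFn l' (w i))‖ₑ :=
            (Summable.tsum_finsetSum fun i _ => ENNReal.summable).symm
        _ ≤ ∑' l', B l l' := by
            refine ENNReal.tsum_le_tsum fun l' => ?_
            by_cases hV : ParaproductVanishing l l' j
            · have h0 : ∀ i, trilin j (blockFn j v) (b i) (blockFn l v) (blockFn l' (w i)) = 0 := fun i =>
                trilin_blockFn_blockFn_eq_zero' hV _ _ hv2 (hw2 i)
              simp only [h0, enorm_zero, Finset.sum_const_zero]
              exact bot_le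
            have hcases : (l ≤ l' - 3 ∧ |l' - j| ≤ 2) ∨ (l' ≤ l - 3 ∧ |l - j| ≤ 2) ∨ (|l' - l| ≤ 2 ∧ j - 4 ≤ l) := by
              unfold ParaproductVanishing at hV
              rw [abs_le, abs_le, abs_le]
              omega
            simp_rw [hblockw _ l']
            rcases hcases with hLH | hHL | hD
            · -- near low–high: sup on the low block, Bernstein on the high one
              calc ∑ i, ‖trilin j (blockFn j v) (b i) (blockFn l v) (fun y => fderiv ℝ (blockFn l' v) y (b i))‖ₑ
                  ≤ ∑ _i : Fin (Module.finrank ℝ (EuclideanSpace ℝ ι)), a j * K.C₂ * s l * (K.Cb * (2 : ℝ≥0∞) ^ l' * a l') := by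
                    refine Finset.sum_le_sum fun i _ => ?_
                    have h := enorm_trilin_fderiv_blockFn_le_lowHigh j K hvj.memLp_two (hvlt l) hv i l'
                    rw [ofReal_two_zpow] at h
                    exact h
                _ = d * (a j * K.C₂ * s l * (K.Cb * (2 : ℝ≥0∞) ^ l' * a l')) := by
                    rw [Finset.sum_const, Finset.card_univ, nsmul_eq_mul]
                _ ≤ d * (a j * K.C₂ * s l * (K.Cb * (64 * (2 : ℝ≥0∞) ^ l) * a l')) := by
                    gcongr
                    exact two_zpow_le_mul_of_le_add_six (by rw [abs_le] at hLH; omega)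
                _ = d * (64 * K.C₂ * K.Cb) * a j * (t l * a l') := by simp only [ht]; ring
                _ ≤ A₁ * a j * (t l * a l') := by
                    gcongr
                    rw [hA₁]
                    gcongr
                    exact le_add_self
                _ ≤ B l l' := by
                    simp only [hB, if_pos hLH]
                    exact le_add_of_le_of_nonneg (le_add_of_le_of_nonneg le_rfl bot_le) bot_le
            · -- high–low: sup on the low derivative block
              calc ∑ i, ‖trilin j (blockFn j v) (b i) (blockFn l v) (fun y => fderiv ℝ (blockFn l' v) y (b i))‖ₑ
                  ≤ ∑ _i : Fin (Module.finrank ℝ (EuclideanSpace ℝ ι)), a j * K.C₂ * a l * (Csup * (2 : ℝ≥0∞) ^ l' * s l') := by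
                    refine Finset.sum_le_sum fun i _ => ?_
                    have h := enorm_trilin_fderiv_blockFn_le_highLow j hvj.memLp_two (hvl2 l) hv (K.two_le j) hCsup i l'
                    rw [ofReal_two_zpow] at h
                    exact h
                _ = A₂ * a j * (a l * t l') := by
                    rw [Finset.sum_const, Finset.card_univ, nsmul_eq_mul]
                    simp only [hA₂, ht]; ring
                _ ≤ B l l' := by
                    simp only [hB, if_pos hHL]
                    exact le_add_of_le_of_nonneg (le_add_of_nonneg_of_le bot_le le_rfl) bot_le
            · -- diagonal: sup on the tested block
              calc ∑ i, ‖trilin j (blockFn j v) (b i) (blockFn l v) (fun y => fderiv ℝ (blockFn l' v) y (b i))‖ₑ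
                  ≤ ∑ _i : Fin (Module.finrank ℝ (EuclideanSpace ℝ ι)), s j * C₁ * a l * (K.Cb * (2 : ℝ≥0∞) ^ l' * a l') := by
                    refine Finset.sum_le_sum fun i _ => ?_
                    have h := enorm_trilin_fderiv_blockFn_le_diag j K (g := blockFn j v) (hvl2 l) hv i l'
                    rw [ofReal_two_zpow] at h
                    exact h
                _ = A₃ * s j * (a l * c l') := by
                    rw [Finset.sum_const, Finset.card_univ, nsmul_eq_mul]
                    simp only [hA₃, hc]; ring
                _ ≤ B l l' := by
                    simp only [hB, if_pos hD]
                    exact le_add_of_nonneg_of_le bot_le le_rfl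
  refine (ENNReal.tsum_le_tsum hstep3).trans (le_of_eq ?_)
  -- Step 4: resummation onto the paraproduct shapes
  simp only [hB]
  simp_rw [ENNReal.tsum_add, ENNReal.tsum_mul_left]
  rw [tsum_tsum_lowHigh_eq t a j, tsum_tsum_highLow_eq t a j, tsum_tsum_diag_eq a c j]
  ring

end Assembly

end Literature.Analysis.FluidPDE

end
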